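import Literature.MathematicalPhysics.QuantumLattice.HartreeFockSDWTorus
import HarnessLib

/-!
# The antiferromagnetic Hartree–Fock upper bound in the thermodynamic limit (square lattice)

Topic `MathematicalPhysics/QuantumLattice`, family `hubbard`; continuation of
`HartreeFockSDWTorus.lean` (`HartreeFock.hubbardTorus_groundEnergyAt_le_sdw_momentum`: on the even
torus of side `L`, `E_L(L^d) ≤ -Σ_k ε_k²/E_k + (U/4)(L^d - Δ²(Σ_k E_k⁻¹)²/L^d)`). Dividing by
`L²` and letting `L → ∞` along the even tori (the limit defining `energyDensity2D` exists along
all `L`, `ThermodynamicLimit.tendsto_energyDensity2D_torus`; the momentum averages are corner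
Riemann sums, `LangerMattis.sum_latticeMomentum_div_eq_cornerRiemannSum`,
`tendsto_cornerRiemannSum`) gives the classical **antiferromagnetic Hartree–Fock (spin-density-wave)
upper bound on the half-filled square-lattice Hubbard energy density**:

  `energyDensity2D t U 1 ≤ -(2π)⁻² ∫_{[-π,π]²} ε(p)²/E(p) dp + U/4 - (U/4) Δ² ((2π)⁻² ∫ dp/E(p))²`,
  `ε(p) = 2t(cos p₁ + cos p₂)`, `E(p) = √(ε(p)² + Δ²)`, every `Δ ≠ 0`

(`energyDensity2D_le_sdw`). At the self-consistent gap this is Langer–Mattis' `E_A(U, x*)`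
(Phys. Lett. 36A (1971) 139, eq. (4), the upper curve of their Fig. 1; Penn 1966); for arbitrary
`Δ` it is the energy of the SDW Slater determinant, an upper bound by the Hartree–Fock variational
principle (Bach–Lieb–Solovej 1994, (2c.36); tree: `HartreeFock.groundEnergyAt_le_hfEnergy`). This
is the statement behind certified "HF-AF" thermodynamic-limit UPPER bounds (which evaluate the two
Brillouin-zone integrals by certified quadrature at a chosen rational `Δ`).

Everything is proved; the only definitions are the integrands (with bodies). No named facts.

## Mathlib / tree search

Tree (REUSED): `hubbardTorus_groundEnergyAt_le_sdw_momentum` (part 2), `ThermodynamicLimit.rectN`,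
`tendsto_energyDensity2D_torus`, `LangerMattis.sum_latticeMomentum_div_eq_cornerRiemannSum`,
`tendsto_cornerRiemannSum`, `brillouin`, `cornerRiemannSum`, `latticeMomentum`
(`HubbardTorus2DEnergyDensity`, `HubbardLangerMattisTorus`, `BrillouinRiemannSum`). Mathlib:
`le_of_tendsto_of_tendsto`, `Filter.Tendsto.mul/.pow/.neg`, `Nat.floor_natCast`.

## References

* J. S. Langer, D. C. Mattis, Phys. Lett. 36A (1971) 139, eqs. (2)–(4) and Fig. 1 (upper curve).
  [LangerMattis1971]
* V. Bach, E. H. Lieb, J. P. Solovej, J. Stat. Phys. 76 (1994) 3, eq. (2c.36). [BachLiebSolovej1994]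
-/

noncomputable section

namespace Literature.MathematicalPhysics.QuantumLattice

namespace HartreeFock

open Matrix Finset Filter Topology Literature.Probability.LatticeModels
  Literature.MathematicalPhysics.QuantumLattice.LangerMattis ThermodynamicLimit
open scoped Topology

variable {d : ℕ}

/-! ### The SDW integrands on the Brillouin zone -/

/-- The tight-binding band `ε(p) = 2t Σ_i cos p_i`. [cite: LangerMattis1971, eq. (3)] -/
def sdwBand (t : ℝ) (p : Fin d → ℝ) : ℝ := t * (2 * ∑ i, Real.cos (p i))

/-- The SDW kinetic integrand `ε(p)² / √(ε(p)² + Δ²)`. [cite: LangerMattis1971, eq. (4)] -/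
def sdwKinIntegrand (t Δ : ℝ) (p : Fin d → ℝ) : ℝ :=
  sdwBand t p ^ 2 * (Real.sqrt (sdwBand t p ^ 2 + Δ ^ 2))⁻¹

/-- The SDW gap integrand `1 / √(ε(p)² + Δ²)`. [cite: LangerMattis1971, eq. (4)] -/
def sdwInvIntegrand (t Δ : ℝ) (p : Fin d → ℝ) : ℝ :=
  (Real.sqrt (sdwBand t p ^ 2 + Δ ^ 2))⁻¹

/-- The band is continuous. [folklore] -/
theorem continuous_sdwBand (t : ℝ) : Continuous (sdwBand (d := d) t) := by
  have hs : Continuous fun p : Fin d → ℝ => ∑ i, Real.cos (p i) :=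
    continuous_finsetSum _ fun i _ => Real.continuous_cos.comp (continuous_apply i)
  unfold sdwBand
  exact continuous_const.mul (continuous_const.mul hs)

/-- `√(ε² + Δ²)` is continuous and nowhere zero for `Δ ≠ 0`. [folklore] -/
theorem continuous_sdwRoot (t Δ : ℝ) :
    Continuous fun p : Fin d → ℝ => Real.sqrt (sdwBand t p ^ 2 + Δ ^ 2) :=
  Real.continuous_sqrt.comp (((continuous_sdwBand t).pow 2).add continuous_const)

/-- `√(ε² + Δ²) ≠ 0` for `Δ ≠ 0`. [folklore] -/
theorem sdwRoot_ne_zero (t : ℝ) {Δ : ℝ} (hΔ : Δ ≠ 0) (p : Fin d → ℝ) :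
    Real.sqrt (sdwBand t p ^ 2 + Δ ^ 2) ≠ 0 :=
  (Real.sqrt_pos.mpr (by positivity)).ne'

/-- The gap integrand is continuous (`Δ ≠ 0`). [folklore] -/
theorem continuous_sdwInvIntegrand (t : ℝ) {Δ : ℝ} (hΔ : Δ ≠ 0) :
    Continuous (sdwInvIntegrand (d := d) t Δ) :=
  (continuous_sdwRoot t Δ).inv₀ (sdwRoot_ne_zero t hΔ)

/-- The kinetic integrand is continuous (`Δ ≠ 0`). [folklore] -/
theorem continuous_sdwKinIntegrand (t : ℝ) {Δ : ℝ} (hΔ : Δ ≠ 0) :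
    Continuous (sdwKinIntegrand (d := d) t Δ) :=
  ((continuous_sdwBand t).pow 2).mul (continuous_sdwInvIntegrand t hΔ)

/-- `ε(p + (π,…,π)) = -ε(p)`. [folklore] -/
theorem sdwBand_add_pi (t : ℝ) (p : Fin d → ℝ) :
    sdwBand t (p + fun _ => Real.pi) = -sdwBand t p := by
  simp only [sdwBand, Pi.add_apply, Real.cos_add_pi, Finset.sum_neg_distrib, mul_neg]

/-- The kinetic integrand is `(π,…,π)`-periodic. [folklore] -/
theorem sdwKinIntegrand_add_pi (t Δ : ℝ) (p : Fin d → ℝ) :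
    sdwKinIntegrand t Δ (p + fun _ => Real.pi) = sdwKinIntegrand t Δ p := by
  simp only [sdwKinIntegrand, sdwBand_add_pi, neg_sq]

/-- The gap integrand is `(π,…,π)`-periodic. [folklore] -/
theorem sdwInvIntegrand_add_pi (t Δ : ℝ) (p : Fin d → ℝ) :
    sdwInvIntegrand t Δ (p + fun _ => Real.pi) = sdwInvIntegrand t Δ p := by
  simp only [sdwInvIntegrand, sdwBand_add_pi, neg_sq]

/-! ### Half filling on the even torus: `N_L(1) = L²` -/

/-- For even `L`, `N_L(1) = 2⌊L²/2⌋ = L²`. [folklore] -/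
theorem rectN_one_of_even {L : ℕ} (hL : Even L) : rectN 1 L = L ^ 2 := by
  obtain ⟨m, rfl⟩ := hL
  have h : (1 : ℝ) * ((m + m : ℕ) : ℝ) ^ 2 / 2 = ((2 * m ^ 2 : ℕ) : ℝ) := by
    push_cast; ring
  rw [rectN, h, Nat.floor_natCast]
  ring

/-! ### The thermodynamic limit -/

/-- **Antiferromagnetic Hartree–Fock (SDW) upper bound on the half-filled square-lattice Hubbard
energy density.** For `U ≥ 0` and every gap parameter `Δ ≠ 0`,

  `energyDensity2D t U 1 ≤ -(2π)⁻² ∫_{[-π,π]²} ε²/√(ε²+Δ²) + U/4 - (U/4) Δ² ((2π)⁻² ∫_{[-π,π]²} 1/√(ε²+Δ²))²`,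

`ε(p) = 2t(cos p₁ + cos p₂)`: the energy per site of the spin-density-wave Slater determinant
(Langer–Mattis eq. (4); minimising over `Δ` gives their upper curve `E_A(U,x*)`), from the
finite-torus bound `hubbardTorus_groundEnergyAt_le_sdw_momentum` along the even tori, the existence
of the limit along all `L` (`tendsto_energyDensity2D_torus`; `U ≥ 0` is used only there) and the
convergence of the momentum Riemann sums. [cite: LangerMattis1971, eq. (4)][cite: BachLiebSolovej1994, eq. (2c.36)] -/
theorem energyDensity2D_le_sdw (t : ℝ) {U : ℝ} (hU : 0 ≤ U) {Δ : ℝ} (hΔ : Δ ≠ 0) :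
    energyDensity2D t U 1 ≤
      -(((2 * Real.pi) ^ 2)⁻¹ * ∫ p in brillouin 2, sdwKinIntegrand t Δ p) + U / 4 -
        U / 4 * Δ ^ 2 * (((2 * Real.pi) ^ 2)⁻¹ * ∫ p in brillouin 2, sdwInvIntegrand t Δ p) ^ 2 := by
  -- the even tori `L = 2(m+2)`
  set φ : ℕ → ℕ := fun m => 2 * (m + 2) with hφdef
  have hφ : Tendsto φ atTop atTop :=
    tendsto_atTop_atTop.2 fun b => ⟨b, fun m hm => by simp only [hφdef]; omega⟩
  have hlim : Tendsto (fun m => groundEnergyAt (fermionTorusGraph 2 (φ m)) t U (rectN 1 (φ m)) /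
      ((φ m : ℕ) : ℝ) ^ 2) atTop (𝓝 (energyDensity2D t U 1)) :=
    (tendsto_energyDensity2D_torus t hU zero_le_one one_lt_two).comp hφ
  -- the Riemann sums converge
  have hK : Tendsto (fun m => ((2 * Real.pi) ^ 2)⁻¹ * cornerRiemannSum (sdwKinIntegrand (d := 2) t Δ) (φ m))
      atTop (𝓝 (((2 * Real.pi) ^ 2)⁻¹ * ∫ p in brillouin 2, sdwKinIntegrand t Δ p)) :=
    ((tendsto_cornerRiemannSum (continuous_sdwKinIntegrand t hΔ).continuousOn).comp hφ).const_mul _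
  have hI : Tendsto (fun m => ((2 * Real.pi) ^ 2)⁻¹ * cornerRiemannSum (sdwInvIntegrand (d := 2) t Δ) (φ m))
      atTop (𝓝 (((2 * Real.pi) ^ 2)⁻¹ * ∫ p in brillouin 2, sdwInvIntegrand t Δ p)) :=
    ((tendsto_cornerRiemannSum (continuous_sdwInvIntegrand t hΔ).continuousOn).comp hφ).const_mul _
  have hb : Tendsto (fun m =>
      -(((2 * Real.pi) ^ 2)⁻¹ * cornerRiemannSum (sdwKinIntegrand (d := 2) t Δ) (φ m)) + U / 4 -
        U / 4 * Δ ^ 2 * (((2 * Real.pi) ^ 2)⁻¹ * cornerRiemannSum (sdwInvIntegrand (d := 2) t Δ) (φ m)) ^ 2)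
      atTop (𝓝 (-(((2 * Real.pi) ^ 2)⁻¹ * ∫ p in brillouin 2, sdwKinIntegrand t Δ p) + U / 4 -
        U / 4 * Δ ^ 2 * (((2 * Real.pi) ^ 2)⁻¹ * ∫ p in brillouin 2, sdwInvIntegrand t Δ p) ^ 2)) :=
    (hK.neg.add_const _).sub ((hI.pow 2).const_mul _)
  refine le_of_tendsto_of_tendsto hlim hb (Eventually.of_forall fun m => ?_)
  -- the finite-volume inequality on the torus of side `L = 2(m+2)`, divided by `L²`
  dsimp only
  have hL3 : 3 ≤ φ m := by simp only [hφdef]; omega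
  have hLe : Even (φ m) := by simp only [hφdef]; exact even_two_mul _
  haveI : NeZero (φ m) := ⟨by omega⟩
  have hLpos : (0 : ℝ) < ((φ m : ℕ) : ℝ) := by exact_mod_cast (show 0 < φ m by omega)
  have hL2 : (0 : ℝ) < ((φ m : ℕ) : ℝ) ^ 2 := by positivity
  have h := hubbardTorus_groundEnergyAt_le_sdw_momentum (d := 2) hLe hL3 t U hΔ
  rw [rectN_one_of_even hLe]
  have hKavg := sum_latticeMomentum_div_eq_cornerRiemannSum (d := 2) (L := φ m)
    (sdwKinIntegrand t Δ) (sdwKinIntegrand_add_pi t Δ)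
  have hIavg := sum_latticeMomentum_div_eq_cornerRiemannSum (d := 2) (L := φ m)
    (sdwInvIntegrand t Δ) (sdwInvIntegrand_add_pi t Δ)
  rw [← hKavg, ← hIavg, div_le_iff₀ hL2]
  have key : (-((∑ k : TorusSite 2 (φ m), sdwKinIntegrand t Δ (latticeMomentum (φ m) k)) /
      ((φ m : ℕ) : ℝ) ^ 2) + U / 4 - U / 4 * Δ ^ 2 *
      ((∑ k : TorusSite 2 (φ m), sdwInvIntegrand t Δ (latticeMomentum (φ m) k)) /
        ((φ m : ℕ) : ℝ) ^ 2) ^ 2) * ((φ m : ℕ) : ℝ) ^ 2 =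
      -(∑ k : TorusSite 2 (φ m), sdwKinIntegrand t Δ (latticeMomentum (φ m) k)) +
        U / 4 * (((φ m : ℕ) : ℝ) ^ 2 - Δ ^ 2 *
          (∑ k : TorusSite 2 (φ m), sdwInvIntegrand t Δ (latticeMomentum (φ m) k)) ^ 2 /
            ((φ m : ℕ) : ℝ) ^ 2) := by
    field_simp
    ring
  rw [key]
  simpa only [sdwKinIntegrand, sdwInvIntegrand, sdwBand] using h

end HartreeFock

end Literature.MathematicalPhysics.QuantumLattice
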